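import Literature.Analysis.FluidPDE.SelfSimilarLiouville
import HarnessLib

/-!
# Tsai 1998, Theorem 2 in its printed WEAK form: no backward self-similar solution satisfying
# local energy estimates

Topic `Literature/Analysis/FluidPDE`; ONE named fact (a result in print that the tree has not
proved, `def … : Prop`, D-0014), typed for the blow-up scenario census (`pub/ns-census`,
`SCENARIO-CENSUS.md` v1.47 row **D3w**, EXCLUDED-IN-PRINT-NOT-TREE) and for ideator ns-idea-2's
LINE «rough-ratio» on row D8 (its stub S4 `TsaiSuitableSelfSimilar`).

T.-P. Tsai, *On Leray's self-similar solutions of the Navier–Stokes equations satisfying local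
energy estimates*, Arch. Rational Mech. Anal. 143 (1998) 29–51 (held text
`paper:doi-10-1007-s002050050099`):

> **Theorem 2** (p. 31). Suppose `u` is a weak solution of (1.1) satisfying the local energy
> estimates (1.4) in the cylinder `Q₁(0, T) = B₁(0) × (T − 1, T)`. If `u` is of the form (1.2)₁,
> then `u` is identically zero.

Here (1.1) is the Navier–Stokes system `u_t − νΔu + u·∇u + ∇p = 0`, `div u = 0` with `ν > 0`;
(1.2)₁ is Leray's backward ansatz `u(x, t) = λ(t) U(λ(t) x)`, `λ(t) = (2a(T − t))^{-1/2}`,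
`a > 0` (the tree's `lerayBackward a T U`); (1.4) (p. 30) is
`ess sup_{t₃<t<T} ∫_B ½|u(x, t)|² dx + ∫_{t₃}^T ∫_B ν|∇u|² dx dt < ∞`; and §2 (p. 33): "in
Theorem 2, we do not require the weak solution `u` to be a Leray–Hopf weak solution. Our only
requirements (apart from self-similarity) are (i) and (ii): the Navier–Stokes equations
[interpreted in the sense of distributions] and the local energy estimates" — suitability in the
sense of [CKN] is PROVED (p. 32), and the profile `U`, a weak solution of Leray's system (1.3) in
`W^{1,2}_loc`, is smooth "by standard regularity theory of stationary Navier–Stokes equations"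
(p. 33). Secondary: Lemarié-Rieusset (2016), Thm. 16.8.

* `Tsai1998_selfSimilar_localEnergy_weak` — **Theorem 2** in the printed weak form, as a named
  fact.

## Relation to the tree (why this is a separate fact)

The tree PROVES Theorem 2 for `C²` profiles: `tsai_selfsimilar_local_energy`
(`SelfSimilarLiouville.lean`: `(U, P)` a pointwise Leray profile `IsLerayProfile ν a U P`, local
energy bounds with the classical `fderiv`) is discharged in `TsaiLocalEnergyHolds.lean`
(CKN's ε-regularity through Robinson–Rodrigo–Sadowski's Thm. 15.3 / Lemma 15.12), and
`tsai1998_profile_smooth` (`TsaiGrowthLemmas.lean`) is the `C² ⇒ C^∞` step. The printed weak form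
needs in addition (a) that a distributional self-similar solution with (1.4) has a profile
`U ∈ W^{1,2}_loc` solving (1.3) weakly and (b) the interior elliptic regularity `W^{1,2}_loc ⇒ C²`
of weak solutions of the stationary system (Tsai p. 33, [Ga II]); (b) is in neither the tree nor
Mathlib, so the weak form is vendored as a fact (its discharge = the tree's theorem + (a) + (b)).

## Rendering (a special case of the printed statement, never stronger)

`ν > 0`, `a > 0`, singular time `T`; the velocity is `lerayBackward a T U` for a profile
`U : ℝ³ → ℝ³` (print's (1.2)₁: only the velocity is assumed self-similar); the pressure is ANY
function `p : ℝ → ℝ³ → ℝ` such that `(u, p)` is a distributional solution on the open cylinder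
`Q₁(0, T)` in the tree's sense `IsDistributionalNSSolutionOn (parabolicCylinderOpens 1 (T, 0)) ν 0 u p`
(CKN (2.2): `u`, `|u|²`, `p` locally integrable, `u` weakly divergence free, momentum equation
against all vector tests — a SUBCLASS of print's "weak solution with a distributional pressure");
(1.4) is rendered by its two halves: `ess sup_{T-1<t<T} ∫_{B₁} |u|² < ∞` and `∇u ∈ L²(Q₁(0,T))`
for a weak spatial gradient `G` of `u` on the cylinder (`HasWeakSpatialGradientOn`, CKN (2.1)),
exactly the vocabulary of `IsSuitableWeakSolutionOn` (whose local energy INEQUALITY is not assumed,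
as in print). Conclusion "`u` is identically zero": for the locally integrable profile this is
`U = 0` almost everywhere (then every slice `u(t) = λ U(λ ·)` vanishes a.e.).

## Mathlib / tree search

`lean search 'Tsai1998_selfSimilar|selfSimilar_localEnergy_weak|TsaiSuitableSelfSimilar' --decl`:
only the `C²` forms above (2026-08-28). Reused: `lerayBackward` (`SelfSimilar.lean`),
`IsDistributionalNSSolutionOn` (`WeakSolution.lean`), `parabolicCylinder(Opens)`,
`HasWeakSpatialGradientOn`, `frobeniusNormSq` (`SuitableWeak.lean`, `VectorCalculus.lean`) — all
through `SelfSimilarLiouville.lean`.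

## References

* T.-P. Tsai, Arch. Rational Mech. Anal. 143 (1998) 29–51: Thm. 2 (p. 31), (1.2), (1.4) (p. 30),
  §2 (p. 33). [`Tsai1998`]
* P. G. Lemarié-Rieusset, *The Navier–Stokes Problem in the 21st Century*, CRC (2016), Thm. 16.8.
  [`LemarieRieusset2016`]
* J. Nečas, M. Růžička, V. Šverák, Acta Math. 176 (1996), Thm. 1 (the `L³` case).
  [`NecasRuzickaSverak1996`]
-/

noncomputable section

open MeasureTheory Set Function Filter Topology TopologicalSpace Metric
open scoped NNReal ENNReal RealInnerProductSpace

namespace Literature.Analysis.FluidPDE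

/-- **Tsai 1998, Theorem 2 (weak form): a backward self-similar distributional solution of
Navier–Stokes satisfying the local energy estimates near the singularity is trivial.**  "Suppose
`u` is a weak solution of (1.1) satisfying the local energy estimates (1.4) in the cylinder
`Q₁(0, T) = B₁(0) × (T − 1, T)`. If `u` is of the form (1.2)₁, then `u` is identically zero"
(only the Navier–Stokes equations in the sense of distributions and (1.4) are required, §2).
Rendered (module docstring): `u = lerayBackward a T U`, `(u, p)` a distributional solution on
`Q₁(0, T)` for some pressure `p`, `ess sup_t ∫_{B₁}|u|² < ∞` and a square-integrable weak spatial
gradient on the cylinder ⇒ `U = 0` a.e.  The `C²`-profile special case is the PROVED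
`tsai_selfsimilar_local_energy`. [cite: Tsai1998, Thm. 2 (p. 31) with (1.2), (1.4) (p. 30) and §2 (p. 33)] -/
def Tsai1998_selfSimilar_localEnergy_weak : Prop :=
  ∀ (ν a T : ℝ), 0 < ν → 0 < a →
    ∀ (U : EuclideanSpace ℝ (Fin 3) → EuclideanSpace ℝ (Fin 3))
      (p : ℝ → EuclideanSpace ℝ (Fin 3) → ℝ),
    IsDistributionalNSSolutionOn
        (parabolicCylinderOpens 1 ((T, 0) : ℝ × EuclideanSpace ℝ (Fin 3))) ν 0
        (lerayBackward a T U) p →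
    (∃ C : ℝ≥0, ∀ᵐ t ∂(volume.restrict (Ioo (T - 1) T)),
        ∫⁻ x in ball (0 : EuclideanSpace ℝ (Fin 3)) 1, ‖lerayBackward a T U t x‖ₑ ^ 2 ≤ C) →
    (∃ G : ℝ → EuclideanSpace ℝ (Fin 3) → EuclideanSpace ℝ (Fin 3) →L[ℝ] EuclideanSpace ℝ (Fin 3),
        HasWeakSpatialGradientOn
            (parabolicCylinderOpens 1 ((T, 0) : ℝ × EuclideanSpace ℝ (Fin 3)))
            (lerayBackward a T U) G ∧
          ∫⁻ z in parabolicCylinder 1 ((T, 0) : ℝ × EuclideanSpace ℝ (Fin 3)),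
              ENNReal.ofReal (frobeniusNormSq (G z.1 z.2)) < ∞) →
    U =ᵐ[volume] 0

/-! ### API -/

namespace Tsai1998_selfSimilar_localEnergy_weak

/-- The fact applied: under the printed hypotheses the profile vanishes a.e.
[cite: Tsai1998, Thm. 2] -/
theorem profile_ae_eq_zero (h : Tsai1998_selfSimilar_localEnergy_weak) {ν a T : ℝ}
    (hν : 0 < ν) (ha : 0 < a) {U : EuclideanSpace ℝ (Fin 3) → EuclideanSpace ℝ (Fin 3)}
    {p : ℝ → EuclideanSpace ℝ (Fin 3) → ℝ}
    (hsol : IsDistributionalNSSolutionOn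
        (parabolicCylinderOpens 1 ((T, 0) : ℝ × EuclideanSpace ℝ (Fin 3))) ν 0
        (lerayBackward a T U) p)
    (henergy : ∃ C : ℝ≥0, ∀ᵐ t ∂(volume.restrict (Ioo (T - 1) T)),
        ∫⁻ x in ball (0 : EuclideanSpace ℝ (Fin 3)) 1, ‖lerayBackward a T U t x‖ₑ ^ 2 ≤ C)
    (hgrad : ∃ G : ℝ → EuclideanSpace ℝ (Fin 3) → EuclideanSpace ℝ (Fin 3) →L[ℝ]
        EuclideanSpace ℝ (Fin 3),
        HasWeakSpatialGradientOn
            (parabolicCylinderOpens 1 ((T, 0) : ℝ × EuclideanSpace ℝ (Fin 3)))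
            (lerayBackward a T U) G ∧
          ∫⁻ z in parabolicCylinder 1 ((T, 0) : ℝ × EuclideanSpace ℝ (Fin 3)),
              ENNReal.ofReal (frobeniusNormSq (G z.1 z.2)) < ∞) :
    U =ᵐ[volume] 0 :=
  h ν a T hν ha U p hsol henergy hgrad

/-- **Every slice vanishes a.e.**: if the profile is a.e. zero then so is each self-similar
slice `u(t) = λ(t) U(λ(t) ·)` for `t < T` (the dilation `x ↦ λ x`, `λ ≠ 0`, preserves null sets).
[cite: Tsai1998, Thm. 2 ("u is identically zero")] -/
theorem slice_ae_eq_zero {a T : ℝ} (ha : 0 < a)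
    {U : EuclideanSpace ℝ (Fin 3) → EuclideanSpace ℝ (Fin 3)} (hU : U =ᵐ[volume] 0)
    {t : ℝ} (ht : t < T) :
    lerayBackward a T U t =ᵐ[volume] 0 := by
  have hpos : 0 < Real.sqrt (2 * a * (T - t)) := Real.sqrt_pos.mpr (by nlinarith)
  have hc0 : (Real.sqrt (2 * a * (T - t)))⁻¹ ≠ 0 := inv_ne_zero hpos.ne'
  have hq := Measure.quasiMeasurePreserving_smul
    (volume : Measure (EuclideanSpace ℝ (Fin 3))) hc0
  filter_upwards [hq.ae_eq hU] with x hx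
  simp only [lerayBackward, Function.comp_apply, Pi.zero_apply] at hx ⊢
  rw [hx, smul_zero]

end Tsai1998_selfSimilar_localEnergy_weak

end Literature.Analysis.FluidPDE
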